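import Mathlib
import Literature.RingTheory.PowerSeries.LaurentSeriesConstants
import Literature.NumberTheory.Transcendental.AxSchanuelUniv
import Literature.FieldTheory.TranscendenceDegree.AlgebraicDependenceBookkeeping
import HarnessLib

/-!
# Route InverseLandau · `SplitDefectLattice` (stmt-KontsevichZagierPeriods-13873) — helpers:
# logarithms of Landau units in the differential field `k⸨X⸩`

Support lemmas for `Theorems/InverseLandauSplitDefectLattice.lean` (the Landau log lattice,
split simple-pole case). Everything PROVED, no definition.

* `exists_algDerivation_eq_derivative` — `d/dX` as a `Derivation k k⸨X⸩ k⸨X⸩` for the `k`-ALGEBRA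
  structure of `k⸨X⸩` (Mathlib's `Algebra k k⸨X⸩` comes through power series and its scalar
  action is not definitionally the coefficientwise one; Ax's theorem is stated for the former).
* `exists_ps_*`, `eq_one_of_mem_range`, `eq_zero_of_mem_range` — power series with constant
  coefficient `1` form a group inside `k⸨X⸩`, and such a series (resp. one with constant
  coefficient `0`) that is a constant of `d/dX` is `1` (resp. `0`): "no constant of integration
  survives at a Tate point".
* `derivation_logSum_eq`, `prod_zpow_eq_one_of_derivation_eq_zero`,
  `logSum_eq_zero_of_prod_zpow_eq_one` — for `Gᵢ ∈ k⟦X⟧` with `Gᵢ(0) = 1` and logarithms `Lᵢ`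
  (`Gᵢ Lᵢ′ = Gᵢ′`, `Lᵢ(0) = 0`): `Π Gᵢ^{Nᵢ} = 1 ↔ Σ Nᵢ Lᵢ = 0`.
* `eq_zero_of_sum_mul_logSum_eq_zero` — the transcendence input, from Ax 1971 Thm. 3 as proved in
  the tree (`Literature.NumberTheory.Transcendental.Ax1971.add_rank_le_trdeg_of_field`, one
  derivation) plus the transcendence-degree bookkeeping of
  `Literature.FieldTheory.TranscendenceDegree`: logarithms `yⱼ = Σᵢ Mⱼᵢ Lᵢ` of multiplicatively
  independent power products of elements of `k[x₁]` are linearly independent over the elements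
  algebraic over `k[x₁]`.

References: J. Ax, *On Schanuel's conjectures*, Ann. of Math. 93 (1971), Thm. 3;
M. Rosenlicht, Pacific J. Math. 65 (1976) (the tree's proof of Ax).
-/

noncomputable section

open scoped LaurentSeries
open HahnSeries
namespace Summit.KontsevichZagierPeriods.InverseLandau.SplitDefect

open Literature.RingTheory.PowerSeries (derivative_one derivative_C derivative_mul
  algebraMap_laurentSeries_apply derivative_coe_powerSeries derivative_eq_zero_iff_mem_range_algebraMap)
open Literature.NumberTheory.Transcendental (inv_mul_derivation_prod_zpow)

/-- `d/dX` as a derivation for the `k`-ALGEBRA structure of `k⸨X⸩`. [folklore] -/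
theorem exists_algDerivation_eq_derivative (k : Type*) [Field k] :
    ∃ D : @Derivation k k⸨X⸩ k⸨X⸩ _ _ _ _ _ Algebra.toModule,
      ∀ f, D f = LaurentSeries.derivative k f := by
  let L : @LinearMap k k _ _ (RingHom.id k) k⸨X⸩ k⸨X⸩ _ _
      Algebra.toModule Algebra.toModule :=
    @LinearMap.mk k k _ _ (RingHom.id k) k⸨X⸩ k⸨X⸩ _ _
      Algebra.toModule Algebra.toModule
      ⟨fun f => LaurentSeries.derivative k f, fun f g => map_add (LaurentSeries.derivative k) f g⟩
      (fun c f => by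
        dsimp only
        rw [RingHom.id_apply, Algebra.smul_def, Algebra.smul_def, algebraMap_laurentSeries_apply,
          derivative_mul, derivative_C, zero_mul, zero_add])
  have hL : ∀ f, L f = LaurentSeries.derivative k f := fun f => rfl
  let D : @Derivation k k⸨X⸩ k⸨X⸩ _ _ _ _ _ Algebra.toModule :=
    @Derivation.mk k k⸨X⸩ k⸨X⸩ _ _ _ _ _ Algebra.toModule L
      (by rw [hL]; exact derivative_one)
      (by
        intro a b
        rw [hL, hL, hL, derivative_mul, smul_eq_mul, smul_eq_mul]
        ring)
  exact ⟨D, fun f => rfl⟩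

variable {k : Type*} [Field k]

/-- Power series with constant coefficient `1` are closed under products in `k⸨X⸩`. [folklore] -/
theorem exists_ps_mul {x y : k⸨X⸩}
    (hx : ∃ p : PowerSeries k, PowerSeries.constantCoeff p = 1 ∧ (p : k⸨X⸩) = x)
    (hy : ∃ p : PowerSeries k, PowerSeries.constantCoeff p = 1 ∧ (p : k⸨X⸩) = y) :
    ∃ p : PowerSeries k, PowerSeries.constantCoeff p = 1 ∧ (p : k⸨X⸩) = x * y := by
  obtain ⟨p, hp, rfl⟩ := hx
  obtain ⟨q, hq, rfl⟩ := hy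
  exact ⟨p * q, by rw [map_mul, hp, hq, one_mul], PowerSeries.coe_mul p q⟩

/-- Power series with constant coefficient `1` are closed under inverses in `k⸨X⸩`. [folklore] -/
theorem exists_ps_inv {x : k⸨X⸩}
    (hx : ∃ p : PowerSeries k, PowerSeries.constantCoeff p = 1 ∧ (p : k⸨X⸩) = x) :
    ∃ p : PowerSeries k, PowerSeries.constantCoeff p = 1 ∧ (p : k⸨X⸩) = x⁻¹ := by
  obtain ⟨p, hp, rfl⟩ := hx
  refine ⟨p⁻¹, by rw [PowerSeries.constantCoeff_inv, hp, inv_one], ?_⟩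
  have h1 : (p⁻¹ : PowerSeries k) * p = 1 := PowerSeries.inv_mul_cancel p (by rw [hp]; exact one_ne_zero)
  have h2 : ((p⁻¹ : PowerSeries k) : k⸨X⸩) * (p : k⸨X⸩) = 1 := by
    rw [← PowerSeries.coe_mul, h1, PowerSeries.coe_one]
  exact eq_inv_of_mul_eq_one_left h2

/-- Power series with constant coefficient `1` are closed under integer powers in `k⸨X⸩`. [folklore] -/
theorem exists_ps_zpow {x : k⸨X⸩}
    (hx : ∃ p : PowerSeries k, PowerSeries.constantCoeff p = 1 ∧ (p : k⸨X⸩) = x) (n : ℤ) :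
    ∃ p : PowerSeries k, PowerSeries.constantCoeff p = 1 ∧ (p : k⸨X⸩) = x ^ n := by
  have hpow : ∀ m : ℕ, ∃ p : PowerSeries k, PowerSeries.constantCoeff p = 1 ∧ (p : k⸨X⸩) = x ^ m := by
    intro m
    induction m with
    | zero => exact ⟨1, map_one _, by rw [pow_zero, PowerSeries.coe_one]⟩
    | succ m ih => rw [pow_succ]; exact exists_ps_mul ih hx
  cases n with
  | ofNat m => rw [Int.ofNat_eq_natCast, zpow_natCast]; exact hpow m
  | negSucc m => rw [zpow_negSucc]; exact exists_ps_inv (hpow (m + 1))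

/-- … and under finite products of integer powers. [folklore] -/
theorem exists_ps_prod_zpow {m : ℕ} (G : Fin m → PowerSeries k)
    (hG : ∀ i, PowerSeries.constantCoeff (G i) = 1) (N : Fin m → ℤ) :
    ∃ p : PowerSeries k, PowerSeries.constantCoeff p = 1 ∧
      (p : k⸨X⸩) = ∏ i, ((G i : PowerSeries k) : k⸨X⸩) ^ N i := by
  classical
  refine Finset.prod_induction (fun i => ((G i : PowerSeries k) : k⸨X⸩) ^ N i)
    (fun x => ∃ p : PowerSeries k, PowerSeries.constantCoeff p = 1 ∧ (p : k⸨X⸩) = x)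
    (fun a b ha hb => exists_ps_mul ha hb) ⟨1, map_one _, PowerSeries.coe_one⟩ ?_
  intro i _
  exact exists_ps_zpow ⟨G i, hG i, rfl⟩ (N i)

/-- A power series with constant coefficient `1` whose image in `k⸨X⸩` is a scalar is `1`. [folklore] -/
theorem eq_one_of_mem_range {x : k⸨X⸩}
    (hx : ∃ p : PowerSeries k, PowerSeries.constantCoeff p = 1 ∧ (p : k⸨X⸩) = x)
    (hc : x ∈ Set.range (algebraMap k k⸨X⸩)) : x = 1 := by
  obtain ⟨p, hp, rfl⟩ := hx
  obtain ⟨c, hc⟩ := hc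
  rw [algebraMap_laurentSeries_apply, ← ofPowerSeries_C, ] at hc
  have hpc : PowerSeries.C c = p := ofPowerSeries_injective hc
  have : c = 1 := by rw [← hp, ← hpc, PowerSeries.constantCoeff_C]
  rw [← hpc, this, map_one, PowerSeries.coe_one]

/-- A power series with constant coefficient `0` whose image in `k⸨X⸩` is a scalar is `0`. [folklore] -/
theorem eq_zero_of_mem_range {p : PowerSeries k} (hp : PowerSeries.constantCoeff p = 0)
    (hc : (p : k⸨X⸩) ∈ Set.range (algebraMap k k⸨X⸩)) : p = 0 := by
  obtain ⟨c, hc⟩ := hc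
  rw [algebraMap_laurentSeries_apply, ← ofPowerSeries_C] at hc
  have hpc : PowerSeries.C c = p := ofPowerSeries_injective hc
  have : c = 0 := by rw [← hp, ← hpc, PowerSeries.constantCoeff_C]
  rw [← hpc, this, map_zero]


section Abstract

variable {K : Type*} [Field K] [Algebra k K] {m : ℕ}

/-- **Logarithmic derivative of a power product.** For a `k`-derivation `D` of a field `K` and
`D zᵢ = zᵢ · D Lᵢ` ("`Lᵢ = log zᵢ`"): `D (Σ Nᵢ Lᵢ) = (Π zᵢ^{Nᵢ})⁻¹ · D (Π zᵢ^{Nᵢ})`. [folklore] -/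
theorem derivation_logSum_eq (D : Derivation k K K)
    (z Lk : Fin m → K) (hz : ∀ i, z i ≠ 0) (hexp : ∀ i, D (z i) = z i * D (Lk i))
    (N : Fin m → ℤ) :
    D (∑ i, (N i : K) * Lk i) = (∏ i, z i ^ N i)⁻¹ * D (∏ i, z i ^ N i) := by
  rw [inv_mul_derivation_prod_zpow D Finset.univ z (fun i _ => hz i) N, map_sum]
  refine Finset.sum_congr rfl fun i _ => ?_
  rw [Derivation.leibniz, Derivation.map_intCast, smul_zero, add_zero, smul_eq_mul, hexp i,
    ← mul_assoc (z i)⁻¹, inv_mul_cancel₀ (hz i), one_mul]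

/-- Reindexing a double logarithmic sum: `Σⱼ qⱼ (Σᵢ Mⱼᵢ Lᵢ) = Σᵢ (Σⱼ qⱼ Mⱼᵢ) Lᵢ`. [folklore] -/
theorem sum_mul_logSum_eq {t : ℕ} (Lk : Fin m → K) (M : Fin t → Fin m → ℤ) (q : Fin t → K) :
    (∑ j, q j * ∑ i, (M j i : K) * Lk i) = ∑ i, (∑ j, q j * (M j i : K)) * Lk i := by
  simp only [Finset.mul_sum, Finset.sum_mul]
  rw [Finset.sum_comm]
  exact Finset.sum_congr rfl fun i _ => Finset.sum_congr rfl fun j _ => by ring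

end Abstract

section Logs

variable [CharZero k] {m : ℕ}

/-- The image of a power series with constant coefficient `1` in `k⸨X⸩` is non-zero. [folklore] -/
theorem coe_ne_zero_of_constantCoeff_eq_one {p : PowerSeries k}
    (hp : PowerSeries.constantCoeff p = 1) : (p : k⸨X⸩) ≠ 0 := by
  intro h
  rw [map_eq_zero_iff _ ofPowerSeries_injective] at h
  rw [h, map_zero] at hp
  exact zero_ne_one hp

/-- **No constant of integration survives at a Tate point (i).** If the logarithmic sum
`Σ Nᵢ Lᵢ` is killed by `d/dX`, then the power product `Π Gᵢ^{Nᵢ}` of power series with constant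
coefficient `1` is a constant with constant coefficient `1`, i.e. equals `1`. [folklore] -/
theorem prod_zpow_eq_one_of_derivation_eq_zero
    (D : @Derivation k k⸨X⸩ k⸨X⸩ _ _ _ _ _ Algebra.toModule)
    (hD : ∀ f, D f = LaurentSeries.derivative k f)
    (G : Fin m → PowerSeries k) (hG : ∀ i, PowerSeries.constantCoeff (G i) = 1)
    (Lk : Fin m → k⸨X⸩)
    (hexp : ∀ i, D ((G i : PowerSeries k) : k⸨X⸩) = ((G i : PowerSeries k) : k⸨X⸩) * D (Lk i))
    (N : Fin m → ℤ) (h0 : D (∑ i, (N i : k⸨X⸩) * Lk i) = 0) :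
    ∏ i, ((G i : PowerSeries k) : k⸨X⸩) ^ N i = 1 := by
  have hz : ∀ i, ((G i : PowerSeries k) : k⸨X⸩) ≠ 0 :=
    fun i => coe_ne_zero_of_constantCoeff_eq_one (hG i)
  have hP0 : ∏ i, ((G i : PowerSeries k) : k⸨X⸩) ^ N i ≠ 0 :=
    Finset.prod_ne_zero_iff.mpr fun i _ => zpow_ne_zero _ (hz i)
  have h1 := derivation_logSum_eq D _ Lk hz hexp N
  rw [h0] at h1
  have h2 : D (∏ i, ((G i : PowerSeries k) : k⸨X⸩) ^ N i) = 0 := by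
    rcases mul_eq_zero.mp h1.symm with h | h
    · exact absurd h (inv_ne_zero hP0)
    · exact h
  rw [hD, derivative_eq_zero_iff_mem_range_algebraMap] at h2
  exact eq_one_of_mem_range (exists_ps_prod_zpow G hG N) h2

/-- **No constant of integration survives at a Tate point (ii).** An exact multiplicative
relation `Π Gᵢ^{Nᵢ} = 1` among power series `Gᵢ` with `Gᵢ(0) = 1` forces the corresponding
combination of their logarithms (pinned by `Lᵢ(0) = 0`) to vanish: `Σ Nᵢ Lᵢ = 0`. [folklore] -/
theorem logSum_eq_zero_of_prod_zpow_eq_one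
    (D : @Derivation k k⸨X⸩ k⸨X⸩ _ _ _ _ _ Algebra.toModule)
    (hD : ∀ f, D f = LaurentSeries.derivative k f)
    (G L : Fin m → PowerSeries k) (hG : ∀ i, PowerSeries.constantCoeff (G i) = 1)
    (hL0 : ∀ i, PowerSeries.constantCoeff (L i) = 0)
    (hexp : ∀ i, D ((G i : PowerSeries k) : k⸨X⸩) =
      ((G i : PowerSeries k) : k⸨X⸩) * D ((L i : PowerSeries k) : k⸨X⸩))
    (N : Fin m → ℤ) (h1 : ∏ i, ((G i : PowerSeries k) : k⸨X⸩) ^ N i = 1) :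
    ∑ i, (N i : PowerSeries k) * L i = 0 := by
  have hz : ∀ i, ((G i : PowerSeries k) : k⸨X⸩) ≠ 0 :=
    fun i => coe_ne_zero_of_constantCoeff_eq_one (hG i)
  have h := derivation_logSum_eq D _ (fun i => ((L i : PowerSeries k) : k⸨X⸩)) hz hexp N
  rw [h1, inv_one, one_mul, hD, hD, derivative_one,
    derivative_eq_zero_iff_mem_range_algebraMap] at h
  have hsum : (∑ i, (N i : k⸨X⸩) * ((L i : PowerSeries k) : k⸨X⸩)) =
      ((∑ i, (N i : PowerSeries k) * L i : PowerSeries k) : k⸨X⸩) := by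
    rw [map_sum]
    exact Finset.sum_congr rfl fun i _ => by rw [map_mul, map_intCast]
  rw [hsum] at h
  have hcc : PowerSeries.constantCoeff (∑ i, (N i : PowerSeries k) * L i) = 0 := by
    rw [map_sum]
    exact Finset.sum_eq_zero fun i _ => by rw [map_mul, hL0 i, mul_zero]
  exact eq_zero_of_mem_range hcc h

end Logs

section Ax

open Literature.FieldTheory.TranscendenceDegree (trdeg_le_card_of_forall_isAlgebraic
  isAlgebraic_adjoin_of_mem)

variable {K : Type*} [Field K] [Algebra k K]

/-- Power products (integer exponents) of elements of a subalgebra `A ⊆ K` are algebraic over `A`.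
[folklore] -/
theorem isAlgebraic_prod_zpow (A : Subalgebra k K) {m : ℕ} (z : Fin m → K) (hz : ∀ i, z i ∈ A)
    (N : Fin m → ℤ) : IsAlgebraic A (∏ i, z i ^ N i) := by
  classical
  set T := Subalgebra.algebraicClosure A K with hT
  have hmem : ∀ i, z i ∈ T := fun i => isAlgebraic_algebraMap (⟨z i, hz i⟩ : A)
  have hzpow : ∀ i, z i ^ N i ∈ T := by
    intro i
    obtain ⟨n, hn | hn⟩ := Int.eq_nat_or_neg (N i)
    · rw [hn, zpow_natCast]; exact pow_mem (hmem i) n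
    · rw [hn, zpow_neg, zpow_natCast]
      exact IsAlgebraic.inv (pow_mem (hmem i) n)
  show (∏ i, z i ^ N i) ∈ T
  exact prod_mem fun i _ => hzpow i

variable [CharZero k] [CharZero K]

/-- **Logarithms of multiplicatively independent functions are linearly independent over the
algebraic functions** (from Ax 1971, Thm. 3, one derivation). Let `D` be a `k`-derivation of `K`
with constants `k`, `zᵢ ∈ k[x₁] ⊆ K` non-zero with logarithms `Lᵢ` (`D zᵢ = zᵢ D Lᵢ`), and let the
integer rows `M₁, …, M_t` be such that no non-trivial integer combination of the `yⱼ = Σᵢ Mⱼᵢ Lᵢ`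
is a constant. Then the `yⱼ` are linearly independent over the elements of `K` algebraic over
`k[x₁]`: Ax gives `trdeg_k k(ȳ, z̄) ≥ t + 1`, while a relation would make everything algebraic over
`k[x₁, (yⱼ)_{j ≠ j₀}]`, of transcendence degree `≤ t`. [cite: Ax1971, Thm. 3] -/
theorem eq_zero_of_sum_mul_logSum_eq_zero (D : Derivation k K K)
    (hC : ∀ x : K, D x = 0 → x ∈ Set.range (algebraMap k K))
    {m t : ℕ} (z Lk : Fin m → K) (hz : ∀ i, z i ≠ 0) (hexp : ∀ i, D (z i) = z i * D (Lk i))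
    (x₁ : K) (hzA : ∀ i, z i ∈ Algebra.adjoin k ({x₁} : Set K))
    (M : Fin t → Fin m → ℤ)
    (hsat : ∀ q : Fin t → ℤ, D (∑ j, (q j : K) * ∑ i, (M j i : K) * Lk i) = 0 → q = 0)
    (a : Fin t → K) (ha : ∀ j, IsAlgebraic (Algebra.adjoin k ({x₁} : Set K)) (a j))
    (hsum : ∑ j, a j * ∑ i, (M j i : K) * Lk i = 0) : ∀ j, a j = 0 := by
  classical
  obtain ⟨y, hy⟩ : ∃ y : Fin t → K, ∀ j, y j = ∑ i, (M j i : K) * Lk i := ⟨_, fun _ => rfl⟩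
  obtain ⟨w, hw⟩ : ∃ w : Fin t → K, ∀ j, w j = ∏ i, z i ^ M j i := ⟨_, fun _ => rfl⟩
  simp only [← hy] at hsat hsum
  set Dv : Fin 1 → Derivation k K K := fun _ => D with hDv
  have hCv : ∀ x : K, (∀ j, Dv j x = 0) → x ∈ Set.range (algebraMap k K) :=
    fun x hx => hC x (hx 0)
  have hwne : ∀ j, w j ≠ 0 := fun j => by
    rw [hw]; exact Finset.prod_ne_zero_iff.mpr fun i _ => zpow_ne_zero _ (hz i)
  have hexpw : ∀ j' j, Dv j' (w j) = w j * Dv j' (y j) := by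
    intro j' j
    show D (w j) = w j * D (y j)
    rw [hy, derivation_logSum_eq D z Lk hz hexp (M j), ← hw, ← mul_assoc,
      mul_inv_cancel₀ (hwne j), one_mul]
  have hind : ∀ q : Fin t → ℤ, (∀ j, Dv j (∑ i, (q i : K) * y i) = 0) → q = 0 :=
    fun q hq => hsat q (hq 0)
  by_contra hne
  push Not at hne
  obtain ⟨j₀, hj₀⟩ := hne
  -- `D (y j₀) ≠ 0`, so the rank term is `≥ 1`
  have hDy : D (y j₀) ≠ 0 := by
    intro h0
    have h := hind (Pi.single j₀ 1) (fun j => by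
      show D (∑ i, ((Pi.single j₀ (1 : ℤ) : Fin t → ℤ) i : K) * y i) = 0
      rw [Finset.sum_eq_single j₀ (fun b _ hb => by simp [hb])
        (fun h => absurd (Finset.mem_univ j₀) h)]
      simpa using h0)
    have := congrFun h j₀
    simp at this
  have hrank : 1 ≤ (Matrix.of fun i j => Dv j (y i)).rank := by
    rw [Matrix.rank]
    by_contra hlt
    push Not at hlt
    have hbot : LinearMap.range (Matrix.of fun i j => Dv j (y i)).mulVecLin = ⊥ :=
      Submodule.finrank_eq_zero.1 (Nat.lt_one_iff.1 hlt)
    have hmem : (Matrix.of fun i j => Dv j (y i)).mulVecLin (Pi.single 0 1) ∈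
        LinearMap.range (Matrix.of fun i j => Dv j (y i)).mulVecLin :=
      LinearMap.mem_range_self _ _
    rw [hbot, Submodule.mem_bot, Matrix.mulVecLin_apply, Matrix.mulVec_single_one] at hmem
    have := congrFun hmem j₀
    simp only [Matrix.col_apply, Matrix.of_apply, Pi.zero_apply, hDv] at this
    exact hDy this
  have hax := Literature.NumberTheory.Transcendental.Ax1971.add_rank_le_trdeg_of_field
    (k := k) (K := K) (m := 1) (n := t) Dv hCv y w hwne hexpw hind
  have ht1 : ((t + 1 : ℕ) : Cardinal) ≤
      Algebra.trdeg k (Algebra.adjoin k (Set.range y ∪ Set.range w)) := by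
    refine le_trans ?_ hax
    exact_mod_cast (by omega : t + 1 ≤ t + (Matrix.of fun i j => Dv j (y i)).rank)
  -- everything is algebraic over `k[x₁, (y j)_{j ≠ j₀}]`
  set s : Finset K := insert x₁ ((Finset.univ.erase j₀).image y) with hs
  have ht0 : 1 ≤ t := Nat.succ_le_of_lt (lt_of_le_of_lt (Nat.zero_le _) j₀.isLt)
  have hcard : s.card ≤ t := by
    calc s.card ≤ ((Finset.univ.erase j₀).image y).card + 1 := Finset.card_insert_le _ _
      _ ≤ (Finset.univ.erase j₀).card + 1 := by gcongr; exact Finset.card_image_le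
      _ = t := by
          rw [Finset.card_erase_of_mem (Finset.mem_univ _), Finset.card_univ, Fintype.card_fin]
          omega
  have hx₁s : x₁ ∈ (s : Set K) := by simp [hs]
  have hle : Algebra.adjoin k ({x₁} : Set K) ≤ Algebra.adjoin k (s : Set K) :=
    Algebra.adjoin_mono (Set.singleton_subset_iff.2 hx₁s)
  set T := Subalgebra.algebraicClosure (Algebra.adjoin k (s : Set K)) K with hT
  have haT : ∀ j, a j ∈ T := fun j => (ha j).tower_top_of_subalgebra_le hle
  have hyT' : ∀ j, j ≠ j₀ → y j ∈ T := fun j hj =>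
    isAlgebraic_adjoin_of_mem (Finset.mem_coe.2 (Finset.mem_insert_of_mem
      (Finset.mem_image_of_mem y (Finset.mem_erase.2 ⟨hj, Finset.mem_univ j⟩))))
  have hyT : ∀ j, y j ∈ T := by
    intro j
    by_cases hj : j = j₀
    · subst hj
      have hsplit := Finset.add_sum_erase Finset.univ (fun j' => a j' * y j') (Finset.mem_univ j)
      rw [hsum] at hsplit
      have hyj : y j = (a j)⁻¹ * -(∑ x ∈ Finset.univ.erase j, a x * y x) := by
        rw [← eq_neg_of_add_eq_zero_left hsplit, ← mul_assoc, inv_mul_cancel₀ hj₀, one_mul]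
      rw [hyj]
      exact T.mul_mem (IsAlgebraic.inv (haT j)) (T.neg_mem (T.sum_mem fun x hx =>
        T.mul_mem (haT x) (hyT' x (Finset.ne_of_mem_erase hx))))
    · exact hyT' j hj
  have hwT : ∀ j, w j ∈ T := fun j => by
    rw [hw j]
    exact (isAlgebraic_prod_zpow (Algebra.adjoin k ({x₁} : Set K)) z hzA (M j)).tower_top_of_subalgebra_le hle
  have hgen : Set.range y ∪ Set.range w ⊆ ((T.restrictScalars k : Subalgebra k K) : Set K) := by
    rintro u (⟨j, rfl⟩ | ⟨j, rfl⟩)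
    · exact hyT j
    · exact hwT j
  have halg : ∀ u ∈ Algebra.adjoin k (Set.range y ∪ Set.range w),
      IsAlgebraic (Algebra.adjoin k (s : Set K)) u := fun u hu => Algebra.adjoin_le hgen hu
  have h2 := trdeg_le_card_of_forall_isAlgebraic
    (Algebra.adjoin k (Set.range y ∪ Set.range w)) s halg
  have : ((t + 1 : ℕ) : Cardinal) ≤ (t : ℕ) := (ht1.trans h2).trans (by exact_mod_cast hcard)
  norm_cast at this
  omega

end Ax

end Summit.KontsevichZagierPeriods.InverseLandau.SplitDefect

end
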